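import Mathlib
import Literature.Computability.Complexity.CircuitClasses
import Literature.Computability.Complexity.ConstantDepth
import Literature.Computability.Complexity.Promise
import Literature.Computability.MetaComplexity.LevinKt
import Literature.Computability.MetaComplexity.LevinKtUpperBounds
import Literature.Computability.MetaComplexity.FormulaModelsAE
import Literature.Computability.MetaComplexity.XorBottomModelsAE
import Literature.Computability.MetaComplexity.EventuallyUnsolvable
import Literature.Computability.MetaComplexity.OliveiraSanthanam2018.ApproxMCSPAC0Magnification
import Literature.Computability.MetaComplexity.OliveiraPichSanthanam2019.GapMKtPMagnification
import HarnessLib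

/-!
# Hirahara (CCC 2020; ToC 2023), Thm. 1.11 items 3 ⟺ 4, Prop. B.1, Thm. 1.12 items 3 ⟺ 4:
# constant-depth lower bounds for `MKtP[O(log N), ·]` — magnification from `N^{1+β}` to every `N^k`
# for `AC⁰_d ∘ XOR` (thresholds `N^{o(1)}`) and for `AC⁰_d` (threshold `N − 1`), and the KNOWN
# `AC⁰_d(N^k)` lower bound at thresholds `N^α`, `α < 1`

S. Hirahara, *Non-disjoint promise problems from meta-computational view of pseudorandom generator
constructions*, Theory of Computing **19**(4) (2023) 1–61 (bib key `Hirahara2023NonDisjoint`;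
conference version 35th CCC (2020), LIPIcs 169, 20:1–20:47, where the three results are numbered
Thm. 11, Prop. 12, Thm. 13). ALL QUOTATIONS AND LOCATORS BELOW ARE FROM THE JOURNAL VERSION, which
is the primary source of this file (hardness-magnification census rows **R60** = Thm. 1.11 and
**R61** = Thm. 1.12, with Prop. B.1 the known-side entry of both).

## The printed statements (verbatim)

Conventions (journal): p. 10, *"A family {Π} of problems is said to be solved by a class ℭ and
denoted by {Π} ∈ ℭ if every problem in the family is solved by some algorithm in ℭ."*; p. 10,
*"Here, AC⁰ ∘ XOR denotes the class of constant-depth circuits that consist of unbounded-fan-in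
AND, OR and XOR gates, and XOR gates are allowed to be present only in the bottom la[y]er."*;
p. 10, *"Let MKtP[O(log N), N^{o(1)}] denote the family of the promise problems MKtP[c log N, N^α]
for constants c, α > 0; here, for functions s, t : ℕ → ℕ, MKtP[s(N), t(N)] denotes the promise
problem of deciding whether Kt(x) ≤ s(|x|) or Kt(x) > t(|x|) on input x."*; p. 21, *"We measure
circuit size by the number of gates (except for the input gates)."*; p. 32, Def. 4.1, *"For a string
x ∈ {0,1}\*, Levin's Kt complexity of x is defined as Kt(x) := min{ |d| + t | U outputs x on input
d in time 2^t }, where U is an efficient universal Turing machine."* — the WHOLE-OUTPUT `Kt` of the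
tree's `UniversalMachine.levinKt` (`|d| + ⌈log₂(time)⌉`; OPS Def. 2.1). (The CCC 2020 version,
Def. 36, uses instead a BITWISE variant, *"min{ |d| + t + 2 | U^d(i) outputs x_i in time 2^t for
every i }"*; this file follows the journal.) The `i.o.` notation: p. 34, *"we say that (E vs 𝒟) is
solved by a ℭ-circuit of size s(N) and denote by (E vs 𝒟) ∈ i.o.ℭ(s(N)) if, for every constant c,
there exists a family of ℭ-circuits {C_N}_{N∈ℕ} of size s(N) such that C_N solves the promise
problem (E^c vs 𝒟)_N for infinitely many N."* — so, for a family, `∉ i.o.ℭ(s)` says that SOME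
member is solved at only finitely many lengths by every size-`s` `ℭ`-family, i.e. (p. 10, items
2–4; p. 39, Prop. 4.22: *"for all sufficiently large N ∈ ℕ, no NOT ∘ ℭ circuit of size N^k can solve
… MKtP[O(log N), N − 1] on input length N"*) FOR ALL LARGE `N` NO `N`-INPUT CIRCUIT of the class
solves that member at length `N` — the tree's `PromiseProblem.EventuallyUnsolvable`.

**Theorem 1.11** (p. 10; *Restatement of Theorem 1.11*, p. 44): *"The following are equivalent.
1. For any constant d, there exists a hitting set generator G = {G_n : {0,1}^{O(log n)} → {0,1}^n}
computable in time n^{O(1)} and secure against linear-size AC⁰_d ∘ XOR circuits. 2. For any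
constant d, for some constant β > 0, (E vs SIZE(2^{o(n)})) ∉ i.o.AC⁰_d(N^{1+β}). 3. For any constant
d, for some constant β > 0, MKtP[O(log N), N^{o(1)}] ∉ i.o.AC⁰_d ∘ XOR(N^{1+β}). 4. For any constants
d, k ∈ ℕ, MKtP[O(log N), N^{o(1)}] ∉ i.o.AC⁰_d ∘ XOR(N^k)."* Proof, p. 44: *"The implications from
Item 4 to Item 3 and from Item 3 to Item 2 are trivial. The implication from Item 2 to Item 1
immediately follows from Theorem 4.29. The implication from Item 1 to Item 4 is a standard approach
for showing a lower bound for MKtP, and follows from Proposition 4.22."* Consequence recorded by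
the author, p. 10: *"Observe that Item 1 of Theorem 1.11 implies a strongly exponential AC⁰ circuit
lower bound for E (i.e., E cannot be computed by AC⁰ circuits of size 2^{o(n)}), which also implies
that EXP ⊄ NC¹ (see, e.g., [3, 58, 28])."*

**Proposition B.1** (p. 11 and App. B, p. 54): *"For any constants α < 1, k, d ∈ ℕ, there exists a
constant c such that MKtP[c log N, N^α] ∉ i.o.AC⁰_d(N^k)."* (p. 11: *"This can be proved by using
the pseudorandom restriction method as in [37, 18, 14]. … Extending Proposition B.1 to the case of
AC⁰ ∘ XOR is sufficient for a breakthrough result in light of Theorem 1.11."*; proof p. 54 via the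
polynomial-time pseudorandom restrictions of Lemma B.2, for each fixed polynomial size bound and
depth, "for all large n".)

**Theorem 1.12** (p. 12; *Restatement of Theorem 1.12*, p. 40): *"The following are equivalent.
1. For any constants d, d′, there exists a constant β > 0 such that (E vs AC̃⁰_{d′}(2^{o(n)};
1 − 2^{−o(n)})) ∉ i.o.AC⁰_d(N^{1+β}). 2. For any constant d, there exists a hitting set generator
G = {G_n : {0,1}^{O(log n)} → {0,1}^n} computable in time n^{O(1)} and secure against linear-size
AC⁰_d circuits. 3. For any constant d, there exist constants c, β > 0 such that MKtP[c log N, N − 1]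
∉ i.o.AC⁰_d(N^{1+β}). 4. For any constants d, k, there exists a constant c > 0 such that
MKtP[c log N, N − 1] ∉ i.o.AC⁰_d(N^k)."* Proof, p. 40: *"Item 1 ⟹ Item 2 follows from Corollary
4.23. Item 2 ⟹ Item 4 follows from Proposition 4.22. Item 4 ⟹ Item 3 is obvious. Item 3 ⟹ Item 1
holds because the truth table of any function in AC̃⁰(2^{o(n)}; 1 − 2^{−o(n)}) has Kt complexity
less than N − 1."*

## What is typed, and what is not

Items 1 and 2 of both theorems speak of HITTING SET GENERATORS and of the non-disjoint `E vs 𝒟`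
problems, for which the tree has no vocabulary; they are NOT typed. Typed are the `MKtP` items:
the per-machine statements `Thm111Item3/4 U`, `Thm112Item3/4 U`, the two NAMED FACTS
`thm111_iff34 : ∀ U, Thm111Item3 U ↔ Thm111Item4 U` and `thm112_iff34 : ∀ U, Thm112Item3 U ↔
Thm112Item4 U` (the printed equivalences 3 ⟺ 4, which pass through Items 1/2 in print — these are
the MAGNIFICATION content: a bound `N^{1+β}` for SOME `β > 0` at every depth is equivalent to the
bound `N^k` for EVERY `k`), the NAMED FACT `thm111_consequence : ∀ U, Thm111Item3 U → ¬ (EXP ⊆ NC1)`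
(Thm. 1.11 (3 ⟹ 1) composed with the author's remark on p. 10; `NC1` is the tree's non-uniform
`NC¹`, as in `chop_thm14`), and the KNOWN lower bound `propB1 : ∀ U, PropB1For U` (a theorem in
print, a named fact here). PROVED here: the "trivial"/"obvious" directions Item 4 ⟹ Item 3 of both
theorems (`thm111Item3_of_item4`, `thm112Item3_of_item4`, `k = 2`, `β = 1`); that Thm. 1.12 Item 4
formally implies the statement of Prop. B.1 (`propB1For_of_thm112Item4`: same YES side, and from the
length where `⌊N^α⌋₊ ≤ N − 1` the NO side `Kt > N − 1` is contained in `Kt > N^α` — the census's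
PARAMETER MISMATCH of row R61 made formal: the open target is the threshold `N − 1`, the theorem is
every threshold `N^α`, `α < 1`); the family-class corollaries (`…_not_mem_promiseLift`: the
pointwise bound implies that no tail of the problem lies in `promiseLift (ACdXORae d s)` /
`promiseLift (ACdSIZEae d M)`, the almost-everywhere classes of rows R22/R2); and the vacuity checks
(the constraints admit the gate-free circuit `x₀` at every length, the YES side contains `1^N` for
every `c ≥ c₀(U)` and `N ≥ 2`, the NO sides are inhabited at every length `N ≥ 2`, and for `α < 1`
eventually `⌊N^α⌋₊ < N − 1`, so the R61 thresholds are genuinely different functions).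

## Rendering (two-sided; every shift is absorbed by a printed quantifier)

* `Kt` = `U.levinKt` for an arbitrary `U : UniversalMachine` (the paper fixes an efficient universal
  machine; all three proofs — pseudorandom restrictions, the HSG construction, Prop. 4.22 — are
  insensitive to the choice up to the `O(log)` simulation overhead absorbed by `∃ c`), hence `∀ U`.
* YES threshold `c log N` ↦ `logThreshold c N = c · ⌊log₂ N⌋` with `c : ℕ`: for `N ≥ 2`,
  `{Kt ≤ c⌊log₂ N⌋} ⊆ {Kt ≤ c log N} ⊆ {Kt ≤ 2⌈c⌉⌊log₂ N⌋}`, and `EventuallyUnsolvable` is monotone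
  in the instance sets (`EventuallyUnsolvable.of_imp`), so under `∃ c` the renderings are equivalent.
  NO thresholds are exact: `Kt > N^α ⟺ Kt > ⌊N^α⌋₊ = powThreshold α N` (integer `Kt`), `Kt > N − 1`
  verbatim (`predThreshold`). The family `MKtP[O(log N), N^{o(1)}] ∉ …` ↦ `∃ c, ∃ α > 0, …` (p. 10
  family convention: a family is solved iff every member is).
* `AC⁰_d ∘ XOR(s)` ↦ the constraint `IsACdXor d s N C := C.IsOver acXorBasis ∧ C.XorAtBottom ∧
  C.acDepth ≤ d ∧ C.sizeWith acWeight ≤ s N` — literally the datum of `ACdXORae d s` (`FamilyAE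
  (IsACdXor d s) = ACdXORae d s`, `rfl`): unbounded fan-in `∧/∨/⊕` gates, parity gates of fan-in `≥ 2`
  reading inputs only, negations free (weight `0` in depth and size). A printed depth-`d` circuit
  with `s` gates and negations at the literals is such a circuit with `acDepth ≤ d + 1` (the XOR
  layer counts) and `sizeWith acWeight ≤ s`; conversely NOT-pushdown turns ours into a printed
  circuit with at most twice the gates (`2N^k ≤ N^{k+1}`); both shifts are absorbed by `∀ d`, `∀ k`
  (resp. `∃ β`). `AC⁰_d(M)` ↦ `IsACd d M N C := C.IsOver acBasis ∧ C.acDepth ≤ d ∧ C.size ≤ M N`, the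
  datum of `ACdSIZEae d M` (row R2's class; `rfl`), with the same two-sided absorption (`size` counts
  NOT gates: `≤ s + #literals ≤ 2N^k`).
* `∉ i.o.ℭ(s)` for one promise problem ↦ `PromiseProblem.EventuallyUnsolvable` (module docstring of
  `EventuallyUnsolvable.lean`); sizes `N^{1+β}` ↦ `powSize (1 + β) N = ⌊N^{1+β}⌋₊`, `N^k` ↦ `N ^ k`.
-/

namespace Literature.Computability.MetaComplexity.Hirahara2020

open Filter Topology Literature.Computability.Complexity Literature.Computability.MetaComplexity
open UniversalMachine OliveiraPichSanthanam2019 OliveiraSanthanam2018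

/-! ### Thresholds and circuit constraints -/

/-- The YES threshold `c log N`, rendered `c · ⌊log₂ N⌋`. [cite: Hirahara2023NonDisjoint, Thm. 1.11 (MKtP[c log N, N^α])] -/
def logThreshold (c N : ℕ) : ℕ := c * Nat.log 2 N

/-- The NO threshold `N − 1` of Thm. 1.12 (`Kt(x) > N − 1`). [cite: Hirahara2023NonDisjoint, Thm. 1.12 (MKtP[c log N, N − 1])] -/
def predThreshold (N : ℕ) : ℕ := N - 1

/-- **`AC⁰_d ∘ XOR` circuits of size `s(N)`** as a constraint on `N`-input circuits: gates from
`acXorBasis`, parity gates (fan-in `≥ 2`) reading inputs only, `acDepth ≤ d`, at most `s N`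
non-negation gates — the datum of the almost-everywhere class `ACdXORae d s` (`familyAE_isACdXor`).
[cite: Hirahara2023NonDisjoint, Thm. 1.11 (AC⁰_d ∘ XOR(s), p. 10)] -/
def IsACdXor (d : ℕ) (s : ℕ → ℕ) (N : ℕ) (C : Circuit (Fin N)) : Prop :=
  C.IsOver acXorBasis ∧ C.XorAtBottom ∧ C.acDepth ≤ d ∧ C.sizeWith acWeight ≤ s N

/-- **`AC⁰_d` circuits of size `M(N)`** as a constraint on `N`-input circuits: gates from `acBasis`,
`acDepth ≤ d`, `size ≤ M N` — the datum of `ACdSIZEae d M` (`familyAE_isACd`).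
[cite: Hirahara2023NonDisjoint, Thm. 1.12 (AC⁰_d(N^k), p. 12)] -/
def IsACd (d : ℕ) (M : ℕ → ℕ) (N : ℕ) (C : Circuit (Fin N)) : Prop :=
  C.IsOver acBasis ∧ C.acDepth ≤ d ∧ C.size ≤ M N

/-- `FamilyAE (IsACdXor d s)` is literally `ACdXORae d s`. [folklore] -/
theorem familyAE_isACdXor (d : ℕ) (s : ℕ → ℕ) : FamilyAE (IsACdXor d s) = ACdXORae d s := rfl

/-- `FamilyAE (IsACd d M)` is literally `ACdSIZEae d M`. [folklore] -/
theorem familyAE_isACd (d : ℕ) (M : ℕ → ℕ) : FamilyAE (IsACd d M) = ACdSIZEae d M := rfl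

/-! ### The typed items -/

/-- **Thm. 1.11, Item 3** for the machine `U`: for every depth `d` there are `β > 0` and a member
`MKtP[c log N, N^α]` (`α > 0`) of the family such that for all large `N` no `AC⁰_d ∘ XOR` circuit of
size `N^{1+β}` solves it at length `N`. [cite: Hirahara2023NonDisjoint, Thm. 1.11 item 3 (Restatement, p. 44)] -/
def Thm111Item3 (U : UniversalMachine) : Prop :=
  ∀ d : ℕ, ∃ β : ℝ, 0 < β ∧ ∃ c : ℕ, ∃ α : ℝ, 0 < α ∧
    (U.gapMKtP (logThreshold c) (powThreshold α)).EventuallyUnsolvable (IsACdXor d (powSize (1 + β)))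

/-- **Thm. 1.11, Item 4** for the machine `U`: for all `d, k` some member `MKtP[c log N, N^α]` is,
for all large `N`, solved by no `AC⁰_d ∘ XOR` circuit of size `N^k`.
[cite: Hirahara2023NonDisjoint, Thm. 1.11 item 4 (Restatement, p. 44)] -/
def Thm111Item4 (U : UniversalMachine) : Prop :=
  ∀ d k : ℕ, ∃ c : ℕ, ∃ α : ℝ, 0 < α ∧
    (U.gapMKtP (logThreshold c) (powThreshold α)).EventuallyUnsolvable (IsACdXor d fun N => N ^ k)

/-- **Thm. 1.12, Item 3** for the machine `U`: for every depth `d` there are `c` and `β > 0` such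
that for all large `N` no `AC⁰_d` circuit of size `N^{1+β}` solves `MKtP[c log N, N − 1]` at length
`N`. [cite: Hirahara2023NonDisjoint, Thm. 1.12 item 3 (Restatement, p. 40)] -/
def Thm112Item3 (U : UniversalMachine) : Prop :=
  ∀ d : ℕ, ∃ c : ℕ, ∃ β : ℝ, 0 < β ∧
    (U.gapMKtP (logThreshold c) predThreshold).EventuallyUnsolvable (IsACd d (powSize (1 + β)))

/-- **Thm. 1.12, Item 4** for the machine `U`: for all `d, k` there is `c` such that for all large
`N` no `AC⁰_d` circuit of size `N^k` solves `MKtP[c log N, N − 1]` at length `N`.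
[cite: Hirahara2023NonDisjoint, Thm. 1.12 item 4 (Restatement, p. 40)] -/
def Thm112Item4 (U : UniversalMachine) : Prop :=
  ∀ d k : ℕ, ∃ c : ℕ,
    (U.gapMKtP (logThreshold c) predThreshold).EventuallyUnsolvable (IsACd d fun N => N ^ k)

/-- **Prop. B.1** for the machine `U` (the KNOWN constant-depth lower bound): for all `0 < α < 1`
and all `k, d` there is `c` such that for all large `N` no `AC⁰_d` circuit of size `N^k` solves
`MKtP[c log N, N^α]` at length `N`. [cite: Hirahara2023NonDisjoint, Prop. B.1 (p. 11; proof App. B, p. 54)] -/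
def PropB1For (U : UniversalMachine) : Prop :=
  ∀ α : ℝ, 0 < α → α < 1 → ∀ k d : ℕ, ∃ c : ℕ,
    (U.gapMKtP (logThreshold c) (powThreshold α)).EventuallyUnsolvable (IsACd d fun N => N ^ k)

/-! ### The named facts -/

/-- **Hirahara, Thm. 1.11, Items 3 ⟺ 4** (hardness magnification for `MKtP[O(log N), N^{o(1)}]`
against `AC⁰_d ∘ XOR`: some `N^{1+β}` bound at every depth ⟺ every `N^k` bound; in print the cycle
4 ⟹ 3 ⟹ 2 ⟹ 1 ⟹ 4 through hitting set generators). The direction 4 ⟹ 3 is `thm111Item3_of_item4`.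
[cite: Hirahara2023NonDisjoint, Thm. 1.11 (Items 3 ⟺ 4; proof p. 44)] -/
def thm111_iff34 : Prop := ∀ U : UniversalMachine, Thm111Item3 U ↔ Thm111Item4 U

/-- **Hirahara, Thm. 1.11 (3 ⟹ 1) with the author's remark on p. 10** (a remark citing
[3, 58, 28], not a numbered result; recorded because it is the summit-side conclusion of census row
R60): Item 3 yields, for every `d`, a logarithmic-seed polynomial-time hitting set generator secure
against linear-size `AC⁰_d ∘ XOR` circuits (Item 1), which *"implies a strongly exponential AC⁰
circuit lower bound for E …, which also implies that EXP ⊄ NC¹ (see, e.g., [3, 58, 28])"* (`NC1` =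
the tree's non-uniform `NC¹`, as in `chop_thm14`).
[cite: Hirahara2023NonDisjoint, Thm. 1.11 (3 ⟹ 1) and remark p. 10 (⟹ EXP ⊄ NC¹)] -/
def thm111_consequence : Prop := ∀ U : UniversalMachine, Thm111Item3 U → ¬ (EXP ⊆ NC1)

/-- **Hirahara, Prop. B.1** (known: `MKtP[c log N, N^α] ∉ i.o.AC⁰_d(N^k)` for `α < 1`, by
polynomial-time pseudorandom restrictions). [cite: Hirahara2023NonDisjoint, Prop. B.1 (p. 11; App. B p. 54)] -/
def propB1 : Prop := ∀ U : UniversalMachine, PropB1For U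

/-- **Hirahara, Thm. 1.12, Items 3 ⟺ 4** (magnification for `MKtP[c log N, N − 1]` against `AC⁰_d`:
some `N^{1+β}` bound at every depth ⟺ every `N^k` bound; in print 4 ⟹ 3 ⟹ 1 ⟹ 2 ⟹ 4 through
hitting set generators secure against `AC⁰_d`). The direction 4 ⟹ 3 is `thm112Item3_of_item4`.
[cite: Hirahara2023NonDisjoint, Thm. 1.12 (Items 3 ⟺ 4; proof p. 40)] -/
def thm112_iff34 : Prop := ∀ U : UniversalMachine, Thm112Item3 U ↔ Thm112Item4 U

/-! ### Threshold and size arithmetic -/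

/-- `⌊N^{1+1}⌋₊ = N²`. [folklore] -/
theorem powSize_one_add_one (N : ℕ) : powSize (1 + 1) N = N ^ 2 := by
  unfold powSize
  rw [show ((1 : ℝ) + 1) = ((2 : ℕ) : ℝ) by norm_num, Real.rpow_natCast, ← Nat.cast_pow,
    Nat.floor_natCast]

/-- For `α < 1` and `N ≥ 2`, `⌊N^α⌋₊ < N`. [folklore] -/
theorem powThreshold_lt_self {α : ℝ} (hα : α < 1) {N : ℕ} (hN : 2 ≤ N) : powThreshold α N < N := by
  have hN1 : (1 : ℝ) < N := by exact_mod_cast hN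
  have hlt : (N : ℝ) ^ α < N := by
    have := Real.rpow_lt_rpow_of_exponent_lt hN1 hα
    rwa [Real.rpow_one] at this
  unfold powThreshold
  exact (Nat.floor_lt (Real.rpow_nonneg (by positivity) α)).2 hlt

/-- **The R61 thresholds separate**: for `α < 1`, eventually `⌊N^α⌋₊ < N − 1`, so `Kt > N − 1`
(Thm. 1.12) is eventually a STRICTLY SMALLER NO side than `Kt > N^α` (Prop. B.1). [folklore] -/
theorem eventually_powThreshold_lt_predThreshold {α : ℝ} (hα : α < 1) :
    ∀ᶠ N : ℕ in atTop, powThreshold α N < predThreshold N := by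
  have h1 : Tendsto (fun x : ℝ => x ^ (α - 1)) atTop (𝓝 0) :=
    (tendsto_rpow_neg_atTop (by linarith : 0 < 1 - α)).congr'
      (Eventually.of_forall fun x => by rw [neg_sub])
  have h2 : ∀ᶠ x : ℝ in atTop, x ^ (α - 1) < 1 / 2 := h1.eventually (eventually_lt_nhds (by norm_num))
  have h3 : ∀ᶠ N : ℕ in atTop, (N : ℝ) ^ (α - 1) < 1 / 2 := tendsto_natCast_atTop_atTop.eventually h2
  filter_upwards [h3, eventually_ge_atTop 2] with N hN hN2
  have hNpos : (0 : ℝ) < N := by exact_mod_cast (by omega : 0 < N)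
  have hN2' : (2 : ℝ) ≤ N := by exact_mod_cast hN2
  have hlt : (N : ℝ) ^ α < (N : ℝ) - 1 := by
    have hsplit : (N : ℝ) ^ α = (N : ℝ) ^ (α - 1) * N := by
      rw [Real.rpow_sub_one hNpos.ne', div_mul_cancel₀ _ hNpos.ne']
    rw [hsplit]
    calc (N : ℝ) ^ (α - 1) * N < 1 / 2 * N := mul_lt_mul_of_pos_right hN hNpos
      _ ≤ N - 1 := by linarith
  unfold powThreshold predThreshold
  rw [Nat.floor_lt (Real.rpow_nonneg hNpos.le α), Nat.cast_sub (by omega : 1 ≤ N), Nat.cast_one]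
  exact hlt

/-! ### The proved directions -/

/-- **Thm. 1.11, Item 4 ⟹ Item 3** (*"trivial"*, p. 44): take `k = 2`, `β = 1`.
[cite: Hirahara2023NonDisjoint, Thm. 1.11 proof p. 44 (Item 4 ⟹ Item 3)] -/
theorem thm111Item3_of_item4 (U : UniversalMachine) (h : Thm111Item4 U) : Thm111Item3 U := by
  intro d
  obtain ⟨c, α, hα, hEU⟩ := h d 2
  refine ⟨1, one_pos, c, α, hα, hEU.anti (Eventually.of_forall fun N E hE => ?_)⟩
  rcases hE with ⟨h₁, h₂, h₃, h₄⟩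
  exact ⟨h₁, h₂, h₃, by simpa [powSize_one_add_one] using h₄⟩

/-- **Thm. 1.12, Item 4 ⟹ Item 3** (*"obvious"*, p. 40): take `k = 2`, `β = 1`.
[cite: Hirahara2023NonDisjoint, Thm. 1.12 proof p. 40 (Item 4 ⟹ Item 3)] -/
theorem thm112Item3_of_item4 (U : UniversalMachine) (h : Thm112Item4 U) : Thm112Item3 U := by
  intro d
  obtain ⟨c, hEU⟩ := h d 2
  refine ⟨c, 1, one_pos, hEU.anti (Eventually.of_forall fun N E hE => ?_)⟩
  rcases hE with ⟨h₁, h₂, h₃⟩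
  exact ⟨h₁, h₂, by simpa [powSize_one_add_one] using h₃⟩

/-- **Thm. 1.12 Item 4 formally implies the statement of Prop. B.1** (row R61's parameter mismatch:
the open target has the SMALLER NO side `Kt > N − 1`; a circuit solving `MKtP[c log N, N^α]` at a
large length solves `MKtP[c log N, N − 1]` there, since eventually `⌊N^α⌋₊ ≤ N − 1`). [folklore] -/
theorem propB1For_of_thm112Item4 (U : UniversalMachine) (h : Thm112Item4 U) : PropB1For U := by
  intro α _ hα1 k d
  obtain ⟨c, hEU⟩ := h d k
  obtain ⟨N₀, hN₀⟩ := eventually_atTop.1 (eventually_powThreshold_lt_predThreshold hα1)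
  refine ⟨c, hEU.of_imp ⟨N₀, fun x hx => ⟨id, fun hno => ?_⟩⟩⟩
  rw [UniversalMachine.mem_gapMKtP_no_iff] at hno ⊢
  exact lt_of_le_of_lt (by exact_mod_cast (hN₀ _ hx).le) hno

/-! ### Family-class corollaries (link to the almost-everywhere classes of rows R22 and R2) -/

/-- Thm. 1.11 Item 4 implies that (every tail of) some member of the family escapes
`promiseLift (ACdXORae d (N ↦ N^k))` — the pointwise bound implies the family bound. [folklore] -/
theorem thm111Item4_not_mem_promiseLift (U : UniversalMachine) (h : Thm111Item4 U) (d k N₀ : ℕ) :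
    ∃ c : ℕ, ∃ α : ℝ, 0 < α ∧
      (U.gapMKtP (logThreshold c) (powThreshold α)).tailFrom N₀ ∉
        promiseLift (ACdXORae d fun N => N ^ k) := by
  obtain ⟨c, α, hα, hEU⟩ := h d k
  exact ⟨c, α, hα, familyAE_isACdXor d _ ▸ hEU.tailFrom_not_mem_promiseLift N₀⟩

/-- Prop. B.1 implies that (every tail of) `MKtP[c log N, N^α]` escapes `promiseLift (ACdSIZEae d
(N ↦ N^k))`, the almost-everywhere `AC⁰_d` class of row R2. [folklore] -/
theorem propB1For_not_mem_promiseLift (U : UniversalMachine) (h : PropB1For U) {α : ℝ} (hα : 0 < α)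
    (hα1 : α < 1) (k d N₀ : ℕ) :
    ∃ c : ℕ, (U.gapMKtP (logThreshold c) (powThreshold α)).tailFrom N₀ ∉
      promiseLift (ACdSIZEae d fun N => N ^ k) := by
  obtain ⟨c, hEU⟩ := h α hα hα1 k d
  exact ⟨c, familyAE_isACd d _ ▸ hEU.tailFrom_not_mem_promiseLift N₀⟩

/-! ### Vacuity checks -/

/-- The constraint `IsACdXor d s` admits the gate-free circuit `x₀` at every length `N ≥ 1`, for
every `d` and `s` (so `EventuallyUnsolvable … (IsACdXor d s)` is never vacuously true for want of
admissible circuits). [folklore] -/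
theorem isACdXor_input (d : ℕ) (s : ℕ → ℕ) (N : ℕ) :
    IsACdXor d s (N + 1) (Circuit.input (0 : Fin (N + 1))) :=
  ⟨Circuit.isOver_input acXorBasis 0, xorAtBottom_input 0,
    by change (Circuit.input (0 : Fin (N + 1))).depthWith acWeight ≤ d
       simp [Circuit.depthWith, Circuit.input],
    by simp [Circuit.sizeWith, Circuit.input]⟩

/-- The constraint `IsACd d M` admits the gate-free circuit `x₀` at every length `N ≥ 1`. [folklore] -/
theorem isACd_input (d : ℕ) (M : ℕ → ℕ) (N : ℕ) :
    IsACd d M (N + 1) (Circuit.input (0 : Fin (N + 1))) :=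
  ⟨Circuit.isOver_input acBasis 0,
    by change (Circuit.input (0 : Fin (N + 1))).depthWith acWeight ≤ d
       simp [Circuit.depthWith, Circuit.input],
    by simp⟩

/-- **YES side inhabited**: there is `c₀` (depending on `U`) such that for every `c ≥ c₀`, every NO
threshold `t` and every `N ≥ 2`, the string `1^N` is a YES instance of `MKtP[c log N, t]`
(`Kt(1^N) ≤ c₀' log N + c₀'`, `LevinKtUpperBounds`). [folklore] -/
theorem exists_forall_ones_mem_yes (U : UniversalMachine) :
    ∃ c₀ : ℕ, ∀ c : ℕ, c₀ ≤ c → ∀ (t : ℕ → ℕ) (N : ℕ), 2 ≤ N →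
      ones N ∈ (U.gapMKtP (logThreshold c) t).yes := by
  obtain ⟨c₁, hc₁⟩ := U.exists_forall_ones_mem_MKtP
  refine ⟨2 * c₁, fun c hc t N hN => ?_⟩
  rw [UniversalMachine.gapMKtP_yes]
  apply hc₁
  have hlog : 1 ≤ Nat.log 2 N := Nat.log_pos one_lt_two hN
  unfold logThreshold
  nlinarith

/-- **NO side of Thm. 1.11 / Prop. B.1 inhabited**: for `α < 1` and every `N ≥ 2` some string of
length `N` has `Kt > N^α`. [folklore] -/
theorem exists_mem_no_powThreshold (U : UniversalMachine) (s : ℕ → ℕ) {α : ℝ} (hα : α < 1) {N : ℕ}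
    (hN : 2 ≤ N) : ∃ x : List Bool, x.length = N ∧ x ∈ (U.gapMKtP s (powThreshold α)).no :=
  U.exists_mem_gapMKtP_no (powThreshold_lt_self hα hN)

/-- **NO side of Thm. 1.12 inhabited**: for every `N ≥ 1` some string of length `N` has
`Kt > N − 1`. [folklore] -/
theorem exists_mem_no_predThreshold (U : UniversalMachine) (s : ℕ → ℕ) {N : ℕ} (hN : 1 ≤ N) :
    ∃ x : List Bool, x.length = N ∧ x ∈ (U.gapMKtP s predThreshold).no :=
  U.exists_mem_gapMKtP_no (by unfold predThreshold; omega)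

end Literature.Computability.MetaComplexity.Hirahara2020
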